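import Summits.ResolutionOfSingularities.ResolutionOfSingularities.Theorems.WildCocycleLU
import HarnessLib

/-!
# WildCocycleLU (2/4) — the graded kinds `λ₁` (CYCLIC, grade 1) and `λ₂` (RANK ≥ 2), inclusions, and THE LAW on `λ₁`

Node «CocycleCut» (decomp-res lens-1 g34), tree file 2/4.

* `WildLogCyclicAbove k O` (λ₁, GRADE 1): the mixed-unit log-diagonal kind `λ″ = WildLogDiagonalMixedAbove`
  ((F1)–(F5) and the Galois/`O′`/residue header VERBATIM) with the action clause «ONE principal unit»:
  `g x′_j = x′_j (1 + η)^{N_j}`, `η ∈ 𝔪_B` ARBITRARY (`η ∈ B = M_𝔪′`, `v′η < 1`) — NO pivot shape — and a moved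
  coordinate.  `λ′ ⊆ λ₁ ⊆ λ″` (`wildLogCyclicAbove_of_wildLogDiagonalUnluckyAbove`,
  `wildLogDiagonalMixedAbove_of_wildLogCyclicAbove`).
* `WildLogRankTwoAbove k O` (λ₂, GRADE ≥ 2): `λ″` VERBATIM plus an `F_p`-INDEPENDENT PAIR of frame cocycles
  (`u_{j₁}^a u_{j₂}^b = gφ/φ`, `φ` a unit of `B` ⇒ `p ∣ a ∧ p ∣ b`).  `λ₂ ⊆ λ″`.
* THE LAW (hypothesis-free, every `d`, every `p`): `relLU_of_wildLogCyclicAbove : WildLogCyclicAbove k O →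
  RelLocalUniformization k K O` — the landed twisted-toric ENGINE `WildTwistedToricLU.exists_twisted_toric_chart`
  is pivot-free; the landed `λ′`-law `relLU_of_wildLogDiagonalUnluckyAbove` is RE-DERIVED as the corollary (control).
File 3: the EXACT CARVE `λ″ ↔ λ₁ ∨ λ₂`.  File 4: toys, `R35`, the cut, the root by name.
-/

noncomputable section

open IsLocalRing Polynomial IntermediateField Literature.AlgebraicGeometry.Resolution
open Summit.ResolutionOfSingularities.ResolutionOfSingularities.Theorems.InvariantDescentLU
open Summit.ResolutionOfSingularities.ResolutionOfSingularities.Theorems.InertDescentLU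
open Summit.ResolutionOfSingularities.ResolutionOfSingularities.Theorems.WildReflectionLU
open Summit.ResolutionOfSingularities.ResolutionOfSingularities.Theorems.WildLogDiagonalLU
open Summit.ResolutionOfSingularities.ResolutionOfSingularities.Theorems.TameQuotientLU
open Summit.ResolutionOfSingularities.ResolutionOfSingularities.Theorems.TameAbelianQuotientLU
open Summit.ResolutionOfSingularities.ResolutionOfSingularities.Theorems.TameTwoStoreyLU
open Summit.ResolutionOfSingularities.ResolutionOfSingularities.Theorems.WildTwistedToricLU

universe u

namespace Summit.ResolutionOfSingularities.ResolutionOfSingularities.Theorems.WildCocycleLU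

section Kinds

variable (k : Type) [Field k] {K : Type} [Field K] [Algebra k K]

/-- **KIND (λ₁) — CYCLIC-COCYCLE LOG-DIAGONAL, GRADE 1** (tag DECIDED by `relLU_of_wildLogCyclicAbove`, every `d`,
every `p`): the mixed-unit log-diagonal kind `λ″ = WildLogDiagonalMixedAbove` VERBATIM — a Galois `ℤ/p`-layer
`K′/K` (`p = char k`), a `G`-stable `O′` above `O` with residues in `k`, and above every f.g. birational model `R ⊆ O`
a `G`-stable f.g. model `M = ι(R)[t₀] ⊆ O′`, regular at the centre, with frame clauses (F1)–(F5) — and the action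
clause «ONE PRINCIPAL UNIT»: `g x′_j = x′_j (1 + η)^{N_j}` for some `η ∈ B = M_𝔪′` with `v′(η) < 1` (`η ∈ 𝔪_B`
ARBITRARY: NO pivot shape `η = w·∏x′^{a′} ∈ M` as in `λ′`) and a MOVED coordinate.  In cohomological terms: all
frame cocycles `u_j = g x′_j / x′_j` lie on ONE line `F_p·[1 + η]` of `H¹(⟨g⟩, B^×)` (grade `r = 1`; `r = 0` is
empty, file 1).  CONTAINS `λ′` (`wildLogCyclicAbove_of_wildLogDiagonalUnluckyAbove`), lies in `λ″`.
NEW INHABITANTS beyond `λ′` on the model (paper, rigorous): the BRIESKORN–PHAM / KUMMER PENCIL TOPS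
`F = Σ x_i^{a_i}` (not all `a_i = 1`), `M = lcm a_i`, `p ∤ M`, `w_n = (1 + nF)^{1/M}` (`w_0 = w_p = 1`),
`B = k[x][w_1, …, w_{p−1}]_𝔪` (étale over `𝔸^m` at `0`: regular, r.s.p. `x`), `g x_i = x_i w_1^{−M/a_i}`,
`g w_n = w_{n+1}/w_1`: then `gF = F/(1 + F)`, `g^p = id`, `N(w_1) = 1`, `(g − 1)B ⊆ F·B` with `F` prime in `B` and
`F ∈ 𝔪²`, so `B` carries NO `λ′`-presentation in any frame (a pivot `η̃ = unit·y^β` would give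
`y_i η̃^{p^v}·unit ∈ F·B`, `F ∤ y_i` ⇒ `F ∣ y^β` ⇒ `F ∣ y_i`, absurd — KERNEL: `false_of_pivot_presentation`, file 4);
smallest: `d = 2`, `F = x₁² + x₂³`, `p ≥ 5` (kernel toy: file 4); non-Abhyankar relatives by fixed arc coordinates as
in `λ′`'s instances.  HONEST SCOPE at the level of PLACES: re-pivoting `λ₁ ↦ λ′` on cofinal models = monomialising
`F` along `v′` = EMBEDDED local uniformization of the hypersurface `{F = 0} ⊂ Spec B` (`dim B = d`) along `v′` —
known for `d ≤ 3` (embedded resolution of excellent surfaces in regular schemes [CossartJannsenSaito2020]), OPEN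
for `d ≥ 4` (the located range) — so `λ₁ ∖ λ′` is a CANDIDATE genuine enlargement; nothing more is claimed.
[cite: KiralyLutkebohmert2013, Thm. 2, Conj. 10] [cite: CossartJannsenSaito2020] [cite: Artin1975] -/
def WildLogCyclicAbove (O : ValuationSubring K) : Prop :=
  ∃ K' : IntermediateField K (AlgebraicClosure K), FiniteDimensional K K' ∧ IsGalois K K' ∧
    (Module.finrank K K').Prime ∧ ((Module.finrank K K' : ℕ) : k) = 0 ∧
    ∃ O' : ValuationSubring K', O'.comap (algebraMap K K') = O ∧
      (∀ g : K' ≃ₐ[K] K', ∀ y : K', y ∈ O' ↔ g y ∈ O') ∧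
      (∀ y ∈ O', ∃ c : k, y - algebraMap k K' c ∈ O'.nonunits) ∧
      ∀ R : Subalgebra k K, R.FG → IsFractionRing R K → R.toSubring ≤ O.toSubring →
        ∃ t₀ : Finset K', modelAbove k R K' t₀ ≤ O'.toSubring ∧
          (∀ g : K' ≃ₐ[K] K', ∀ y ∈ modelAbove k R K' t₀, g y ∈ modelAbove k R K' t₀) ∧
          IsRegularLocalRing (locAtCentre (modelAbove k R K' t₀) O') ∧
          ∃ d : ℕ, ∃ x x' : Fin d → K', ∃ A : Fin d → Fin d → ℕ, ∃ η : K', ∃ g : K' ≃ₐ[K] K', ∃ N : Fin d → ℤ,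
            ringKrullDim (locAtCentre (modelAbove k R K' t₀) O') = d ∧
            (∀ i, x i ∈ locAtCentre (modelAbove k R K' t₀) O' ∧ O'.valuation (x i) < 1) ∧
            (∀ b ∈ locAtCentre (modelAbove k R K' t₀) O', O'.valuation b < 1 →
              ∃ c : Fin d → K', (∀ i, c i ∈ locAtCentre (modelAbove k R K' t₀) O') ∧ b = ∑ i, c i * x i) ∧
            (∀ j, x' j ≠ 0 ∧ x' j ∈ O' ∧ O'.valuation (x' j) < 1 ∧
              ∃ a b : K', a ∈ modelAbove k R K' t₀ ∧ b ∈ modelAbove k R K' t₀ ∧ x' j = a / b) ∧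
            (∀ i, x i = ∏ j, x' j ^ A i j) ∧
            (η ∈ locAtCentre (modelAbove k R K' t₀) O' ∧ O'.valuation η < 1) ∧
            (∀ j, g (x' j) = x' j * (1 + η) ^ (N j)) ∧
            ∃ j, g (x' j) ≠ x' j

/-- **KIND (λ₂) — LOG-DIAGONAL OF COCYCLE RANK ≥ 2** (tag UNDECIDED · IDEA-NEEDED): the mixed-unit log-diagonal
kind `λ″ = WildLogDiagonalMixedAbove` VERBATIM plus an `F_p`-INDEPENDENT PAIR of frame cocycles: for some
`j₁, j₂`, `(g x′_{j₁}/x′_{j₁})^a (g x′_{j₂}/x′_{j₂})^b = gφ/φ` with `φ` a unit of `B = M_𝔪′` forces `p ∣ a` and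
`p ∣ b` (`p = [K′:K]`) — the classes `[u_{j₁}], [u_{j₂}] ∈ H¹(⟨g⟩, B^×)` span a PLANE (grade `r ≥ 2`).  By the
EXACT CARVE (file 3) `λ″ ↔ λ₁ ∨ λ₂`: this kind IS the remainder of the log-diagonal world after the cyclic cut.
TEST DATA (registry I176 (c″), the two-pivot top): `d = 3`, `g x_i = x_i/(1 + x_i)` (`i = 1, 2`), `g x₃ = x₃`,
`B = k[x₁, x₂, x₃]_𝔪`: rank EXACTLY `2` (restrict `u₁^a u₂^b = gφ/φ` to the `g`-stable axis `x₂ = x₃ = 0`; with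
`s = 1/x₁`, `g s = s + 1`, the element `φ̄ s^a ∈ k(s)^g = k(s^p − s)` has `s`-degree `≡ 0 (mod p)`, so `p ∣ a`;
symmetrically `p ∣ b`) — a MODEL-level datum; at PLACE level (census I183 «T-twopivot», HOME/census/lu/r34class/T-R34class.md
§ADDENDUM 2): above the rank-3 value group `(1, ∛2, ∛4)` this top is dominated by PSEUDO-REFLECTION monomial models at every
depth `≤ 6` (`p = 2, 3, 5`; inside ROW 234's cell off the ladder), while the `d = 2` two-pivot top with `p = 5`,
`v(x₂) = [0;3,1̄]` has NO pseudo-reflection Perron chart to depth `44` — the candidate GENUINE `λ₂` place (its `d ≥ 4` arc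
relatives are the first instances a `λ₂`-law must decide); its ring of invariants contains the ARTIN–SCHREIER-PENCIL element
`Z = X Y (1/x₂ − 1/x₁)`, `X = N(x₁) = x₁^p/(1 − x₁^{p−1}) = 1/℘(1/x₁)`, with `Z^p − (XY)^{p−1} Z = (XY)^{p−1}(X − Y)`
(`p = 2`: Artin's `D₄¹`, `z² + xyz + x²y + xy²`) — NOT a twisted monomial: for TRUE rank `r ≥ 2` the twisted-toric
ring has index `p^r > p = [K′ : K′^g]` in the invariants, so NO `r`-fold twisted toric structure theorem exists and
the twisted-toric ENGINE cannot decide this kind (kernel toy of the pencil invariants: file 4).  What would DECIDE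
it (a later +1 door): resolving, `G`-equivariantly or downstairs, wild quotients with POSITIVE-dimensional fixed
locus and NON-cyclic cocycle group (`d = 2` core: Artin–Schreier-pencil quotient surface singularities).
[cite: KiralyLutkebohmert2013, Thm. 2] [cite: Artin1975] [cite: Peskin1983, Thm. 3.8] -/
def WildLogRankTwoAbove (O : ValuationSubring K) : Prop :=
  ∃ K' : IntermediateField K (AlgebraicClosure K), FiniteDimensional K K' ∧ IsGalois K K' ∧
    (Module.finrank K K').Prime ∧ ((Module.finrank K K' : ℕ) : k) = 0 ∧
    ∃ O' : ValuationSubring K', O'.comap (algebraMap K K') = O ∧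
      (∀ g : K' ≃ₐ[K] K', ∀ y : K', y ∈ O' ↔ g y ∈ O') ∧
      (∀ y ∈ O', ∃ c : k, y - algebraMap k K' c ∈ O'.nonunits) ∧
      ∀ R : Subalgebra k K, R.FG → IsFractionRing R K → R.toSubring ≤ O.toSubring →
        ∃ t₀ : Finset K', modelAbove k R K' t₀ ≤ O'.toSubring ∧
          (∀ g : K' ≃ₐ[K] K', ∀ y ∈ modelAbove k R K' t₀, g y ∈ modelAbove k R K' t₀) ∧
          IsRegularLocalRing (locAtCentre (modelAbove k R K' t₀) O') ∧
          ∃ d : ℕ, ∃ x x' : Fin d → K', ∃ A : Fin d → Fin d → ℕ, ∃ g : K' ≃ₐ[K] K',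
            ringKrullDim (locAtCentre (modelAbove k R K' t₀) O') = d ∧
            (∀ i, x i ∈ locAtCentre (modelAbove k R K' t₀) O' ∧ O'.valuation (x i) < 1) ∧
            (∀ b ∈ locAtCentre (modelAbove k R K' t₀) O', O'.valuation b < 1 →
              ∃ c : Fin d → K', (∀ i, c i ∈ locAtCentre (modelAbove k R K' t₀) O') ∧ b = ∑ i, c i * x i) ∧
            (∀ j, x' j ≠ 0 ∧ x' j ∈ O' ∧ O'.valuation (x' j) < 1 ∧
              ∃ a b : K', a ∈ modelAbove k R K' t₀ ∧ b ∈ modelAbove k R K' t₀ ∧ x' j = a / b) ∧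
            (∀ i, x i = ∏ j, x' j ^ A i j) ∧
            (∀ j, ∃ u : K', u ∈ locAtCentre (modelAbove k R K' t₀) O' ∧
              u⁻¹ ∈ locAtCentre (modelAbove k R K' t₀) O' ∧ g (x' j) = x' j * u) ∧
            (∃ j, g (x' j) ≠ x' j) ∧
            ∃ j₁ j₂ : Fin d, ∀ a b : ℤ, ∀ φ : K', φ ∈ locAtCentre (modelAbove k R K' t₀) O' →
              φ⁻¹ ∈ locAtCentre (modelAbove k R K' t₀) O' →
              (g (x' j₁) / x' j₁) ^ a * (g (x' j₂) / x' j₂) ^ b = g φ / φ →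
              ((Module.finrank K K' : ℕ) : ℤ) ∣ a ∧ ((Module.finrank K K' : ℕ) : ℤ) ∣ b

variable {k}

set_option maxHeartbeats 400000 in
/-- The kind `λ′` lies in `λ₁`: forget the pivot shape (`η ∈ M ⊆ B`), keep `v′η < 1` and the twist; the coordinate
with `N_j ≠ 0` is MOVED (`one_add_zpow_ne_one`, `p = char k` USED). [folklore] -/
theorem wildLogCyclicAbove_of_wildLogDiagonalUnluckyAbove {O : ValuationSubring K}
    (h : WildLogDiagonalUnluckyAbove k O) : WildLogCyclicAbove k O := by
  classical
  obtain ⟨K', hfd, hgal, hprime, hchar, O', hO'O, hGO', hκ', hLU⟩ := h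
  refine ⟨K', hfd, hgal, hprime, hchar, O', hO'O, hGO', hκ', fun R hRfg hRfrac hRO => ?_⟩
  obtain ⟨t₀, hMO, hGM, hreg, d, x, x', A, η, w, a', g, N, hdim, hx, hgen, hx', hmon, hpiv, htw, j₁, hj₁⟩ :=
    hLU R hRfg hRfrac hRO
  set p : ℕ := Module.finrank K K' with hpdef
  haveI hpF : Fact p.Prime := ⟨hprime⟩
  haveI : CharP k p := ringChar.of_eq (CharP.ringChar_of_prime_eq_zero hprime hchar)
  haveI : CharP K' p := charP_of_injective_algebraMap (algebraMap k K').injective p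
  obtain ⟨hηM, hηv, hwB, hwv, hηeq⟩ := hpiv
  have hη0 : η ≠ 0 := by
    rw [hηeq]
    exact mul_ne_zero (ne_zero_of_valuation_eq_one hwv)
      (Finset.prod_ne_zero_iff.mpr fun j _ => pow_ne_zero _ (hx' j).1)
  refine ⟨t₀, hMO, hGM, hreg, d, x, x', A, η, g, N, hdim, hx, hgen, hx', hmon,
    ⟨le_locAtCentre _ O' hηM, hηv⟩, htw, j₁, fun e => ?_⟩
  rw [htw j₁] at e
  have h1 : (1 + η) ^ N j₁ = 1 := mul_left_cancel₀ (hx' j₁).1 (e.trans (mul_one (x' j₁)).symm)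
  exact one_add_zpow_ne_one O' p (hMO hηM) hηv hη0 hj₁ h1

/-- `λ₁` lies in `λ″`: `u_j := (1 + η)^{N_j}` is a unit of `B` (`1 + η ∈ B`, `v′(1 + η) = 1`). [folklore] -/
theorem wildLogDiagonalMixedAbove_of_wildLogCyclicAbove {O : ValuationSubring K}
    (h : WildLogCyclicAbove k O) : WildLogDiagonalMixedAbove k O := by
  classical
  obtain ⟨K', hfd, hgal, hprime, hchar, O', hO'O, hGO', hκ', hLU⟩ := h
  refine ⟨K', hfd, hgal, hprime, hchar, O', hO'O, hGO', hκ', fun R hRfg hRfrac hRO => ?_⟩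
  obtain ⟨t₀, hMO, hGM, hreg, d, x, x', A, η, g, N, hdim, hx, hgen, hx', hmon, ⟨hηB, hηv⟩, htw, j₁, hj₁⟩ :=
    hLU R hRfg hRfrac hRO
  set M : Subring K' := modelAbove k R K' t₀ with hMdef
  have h1M : (1 + η) ∈ locAtCentre M O' := (locAtCentre M O').add_mem (locAtCentre M O').one_mem hηB
  have h1inv : (1 + η)⁻¹ ∈ locAtCentre M O' := inv_mem_locAtCentre h1M (valuation_one_add_eq_one O' hηv)
  refine ⟨t₀, hMO, hGM, hreg, d, x, x', A, g, hdim, hx, hgen, hx', hmon, fun j => ?_, j₁, hj₁⟩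
  refine ⟨(1 + η) ^ N j, zpow_mem_of_inv_mem _ h1M h1inv (N j), ?_, htw j⟩
  rw [← zpow_neg]
  exact zpow_mem_of_inv_mem _ h1M h1inv (-N j)

/-- `λ₂` lies in `λ″` (forget the independent pair). [folklore] -/
theorem wildLogDiagonalMixedAbove_of_wildLogRankTwoAbove {O : ValuationSubring K}
    (h : WildLogRankTwoAbove k O) : WildLogDiagonalMixedAbove k O := by
  obtain ⟨K', hfd, hgal, hprime, hchar, O', hO'O, hGO', hκ', hLU⟩ := h
  refine ⟨K', hfd, hgal, hprime, hchar, O', hO'O, hGO', hκ', fun R hRfg hRfrac hRO => ?_⟩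
  obtain ⟨t₀, hMO, hGM, hreg, d, x, x', A, g, hdim, hx, hgen, hx', hmon, hu, hmv, -⟩ := hLU R hRfg hRfrac hRO
  exact ⟨t₀, hMO, hGM, hreg, d, x, x', A, g, hdim, hx, hgen, hx', hmon, hu, hmv⟩

/-- Hence `λ′ ⊆ λ″` factors through `λ₁` (agrees with the landed `wildLogDiagonalMixedAbove_of_wildLogDiagonalUnluckyAbove`). -/
example {O : ValuationSubring K} (h : WildLogDiagonalUnluckyAbove k O) : WildLogDiagonalMixedAbove k O :=
  wildLogDiagonalMixedAbove_of_wildLogCyclicAbove (wildLogCyclicAbove_of_wildLogDiagonalUnluckyAbove h)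

end Kinds

/-! ## THE LAW on `λ₁` -/
section Law

variable (k : Type) [Field k] {K : Type} [Field K] [Algebra k K]

variable {k}

set_option maxHeartbeats 1600000 in
/-- **THE LAW OF THE CYCLIC-COCYCLE KIND `λ₁`** (hypothesis-free, every `d`, every `p`):
`WildLogCyclicAbove k O → RelLocalUniformization k K O`, by the Frobenius/Hilbert-90-twisted toric quotient of
the landed node «TwistedToricCut» — whose ENGINE `exists_twisted_toric_chart` never needed the pivot shape: its
hypotheses are the action `σ x_i = x_i (1 + η)^{(A·N)_i}` on the generating system, `η ∈ B ∩ 𝔪′ ∖ 0` and NORM ONE.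
Consumed: the r.s.p. clauses, `x = x′^A`, the single-unit clause with `η ∈ B`, `v′η < 1`, the MOVED coordinate
(for `η ≠ 0`, `N_{j₁} ≠ 0`, `g ≠ 1` and NORM ONE `norm_eq_one`), residues in `k`, `([K′:K] : k) = 0` (for `CharP`).
NOT used: any pivot / monomial shape of `η`, any luckiness.  The landed `λ′`-law is the corollary below.
[this node; cites: KiralyLutkebohmert2013 Ex. 6, Rem. 3; CossartPiltant2008 Lemma 9.4; Fulton1993Toric §2.6] -/
theorem relLU_of_wildLogCyclicAbove {O : ValuationSubring K} (h : WildLogCyclicAbove k O) :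
    RelLocalUniformization k K O := by
  classical
  obtain ⟨K', hfd, hgal, hprime, hchar, O', hO'O, hGO', hκ', hLU⟩ := h
  haveI := hfd
  haveI := hgal
  intro R hRfg hRfrac hRO
  haveI := hRfrac
  obtain ⟨t₀, hMO, hGM, hMreg, d, x, x', A, η, g, N, hdim, hx, hgen, hx', hmon, ⟨hηB, hηv⟩, htw, j₁, hj₁⟩ :=
    hLU R hRfg hRfrac hRO
  -- the prime `p = [K′ : K] = char k = char K′`
  set p : ℕ := Module.finrank K K' with hpdef
  haveI hpF : Fact p.Prime := ⟨hprime⟩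
  haveI : CharP k p := ringChar.of_eq (CharP.ringChar_of_prime_eq_zero hprime hchar)
  haveI : CharP K' p := charP_of_injective_algebraMap (algebraMap k K').injective p
  have hpE : (p : K') = 0 := CharP.cast_eq_zero K' p
  let ι : K →+* K' := (algebraMap K K' : K →+* K')
  have hgf : ∀ (g : K' ≃ₐ[K] K') (x : K), g (ι x) = ι x := fun g x => g.commutes x
  have hfk : ∀ c : k, ι (algebraMap k K c) = algebraMap k K' c := fun c =>
    (IsScalarTower.algebraMap_apply k K K' c).symm
  -- the finite frame `Gfin ⊆ K′ ≃+* K′`, fixed field `ι(K)`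
  let Gfin : Finset (K' ≃+* K') := Finset.univ.image fun g : K' ≃ₐ[K] K' => (g : K' ≃+* K')
  have hGfin : ∀ g' ∈ Gfin, ∃ g : K' ≃ₐ[K] K', (g : K' ≃+* K') = g' := fun g' hg' => by
    obtain ⟨g, -, hg⟩ := Finset.mem_image.mp hg'
    exact ⟨g, hg⟩
  have hmemGfin : ∀ g : K' ≃ₐ[K] K', (g : K' ≃+* K') ∈ Gfin := fun g =>
    Finset.mem_image.mpr ⟨g, Finset.mem_univ _, rfl⟩
  have hcoe1 : ((1 : K' ≃ₐ[K] K') : K' ≃+* K') = 1 := RingEquiv.ext fun _ => rfl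
  have hcoemul : ∀ g g' : K' ≃ₐ[K] K', ((g * g' : K' ≃ₐ[K] K') : K' ≃+* K') =
      (g : K' ≃+* K') * (g' : K' ≃+* K') := fun _ _ => RingEquiv.ext fun _ => rfl
  have hcoepow : ∀ (g : K' ≃ₐ[K] K') (n : ℕ), ((g ^ n : K' ≃ₐ[K] K') : K' ≃+* K') = (g : K' ≃+* K') ^ n := by
    intro g n
    induction n with
    | zero => rw [pow_zero, pow_zero, hcoe1]
    | succ n ih => rw [pow_succ, pow_succ, hcoemul, ih]
  have h1G : (1 : K' ≃+* K') ∈ Gfin := hcoe1 ▸ hmemGfin 1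
  have hmulG : ∀ a ∈ Gfin, ∀ b ∈ Gfin, a * b ∈ Gfin := by
    intro a ha b hb
    obtain ⟨g, rfl⟩ := hGfin a ha
    obtain ⟨g', rfl⟩ := hGfin b hb
    rw [← hcoemul]
    exact hmemGfin _
  let Kfix : Subfield K' := ι.fieldRange
  have hKfix : ∀ z : K', z ∈ Kfix ↔ ∀ h ∈ Gfin, h z = z := by
    intro z
    constructor
    · intro hz h hh
      obtain ⟨x, rfl⟩ := RingHom.mem_fieldRange.mp hz
      obtain ⟨g, rfl⟩ := hGfin h hh
      exact hgf g x
    · intro hz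
      obtain ⟨x, hx⟩ := exists_algebraMap_eq_of_fixed_all (K := K) fun g => hz _ (hmemGfin g)
      exact RingHom.mem_fieldRange.mpr ⟨x, hx⟩
  have hHO : ∀ h ∈ Gfin, ∀ z : K', z ∈ O' ↔ h z ∈ O' := by
    intro h hh z
    obtain ⟨g, rfl⟩ := hGfin h hh
    exact hGO' g z
  -- the model `M = ι(R)[t₀]` over the constants `S′ = ι(R)`
  set S' : Subring K' := R.toSubring.map ι with hS'def
  set M : Subring K' := modelAbove k R K' t₀ with hMdef
  have hMgen : M = Subring.closure ((S' : Set K') ∪ (t₀ : Set K')) := rfl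
  have hS'M : S' ≤ M := fun w hw => Subring.subset_closure (Or.inl hw)
  have hRS : ∀ x ∈ R, ι x ∈ S' := fun x hx => Subring.mem_map.mpr ⟨x, hx, rfl⟩
  have hS'K : S' ≤ Kfix.toSubring := by
    rintro w hw
    obtain ⟨x, -, rfl⟩ := Subring.mem_map.mp hw
    exact RingHom.mem_fieldRange.mpr ⟨x, rfl⟩
  have hkS : ∀ c : k, algebraMap k K' c ∈ S' := fun c => by
    rw [← hfk]; exact hRS _ (R.algebraMap_mem c)
  have hMH : ∀ h ∈ Gfin, ∀ z ∈ M, h z ∈ M := by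
    intro h hh z hz
    obtain ⟨g, rfl⟩ := hGfin h hh
    exact hGM g z hz
  haveI : Algebra.FiniteType k R := (Subalgebra.fg_iff_finiteType R).mp hRfg
  haveI : IsNoetherianRing R := Algebra.FiniteType.isNoetherianRing k R
  haveI hS'noeth : IsNoetherianRing S' :=
    isNoetherianRing_of_surjective R S' (ι.restrict R S' hRS) (by
      rintro ⟨w, hw⟩
      obtain ⟨x, hx, rfl⟩ := Subring.mem_map.mp hw
      exact ⟨⟨x, hx⟩, rfl⟩)
  have hSuc : IsUniversallyCatenaryRing S' :=
    (isUniversallyCatenaryRing_of_finiteType_field k R).of_surjective (ι.restrict R S' hRS) (by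
      rintro ⟨y, hy⟩
      obtain ⟨z, hz, rfl⟩ := Subring.mem_map.mp hy
      exact ⟨⟨z, hz⟩, rfl⟩)
  have hresO : ∀ y ∈ O', ∃ c ∈ S', O'.valuation (y - c) < 1 := fun y hy => by
    obtain ⟨c, hc⟩ := hκ' y hy
    exact ⟨algebraMap k K' c, hkS c, (O'.mem_nonunits_iff).mp hc⟩
  -- the MOVED coordinate: `N_{j₁} ≠ 0`, `η ≠ 0`, `g ≠ 1`; `η ∈ O′`
  have hN : N j₁ ≠ 0 := fun h0 => hj₁ (by rw [htw j₁, h0, zpow_zero, mul_one])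
  have hη0 : η ≠ 0 := fun h0 => hj₁ (by rw [htw j₁, h0, add_zero, one_zpow, mul_one])
  have hηO : η ∈ O' := locAtCentre_le hMO hηB
  have hg1 : g ≠ 1 := by
    rintro rfl
    exact hj₁ (AlgEquiv.one_apply (x' j₁))
  -- the datum `σ = g`: `σ^p = 1`, `E^σ = ι(K)`
  set σ : K' ≃+* K' := (g : K' ≃+* K') with hσdef
  have hσG : σ ∈ Gfin := hmemGfin g
  have hσO : ∀ z : K', z ∈ O' ↔ σ z ∈ O' := hGO' g
  have hcard : Nat.card (K' ≃ₐ[K] K') = p := IsGalois.card_aut_eq_finrank K K'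
  have hσp : σ ^ p = 1 := by
    have hgp : g ^ p = 1 := by rw [← hcard]; exact pow_card_eq_one'
    rw [hσdef, ← hcoepow, hgp, hcoe1]
  have hfixall : ∀ z : K', g z = z → ∀ g' : K' ≃ₐ[K] K', g' z = z := by
    intro z hz g'
    obtain ⟨m, rfl⟩ := (Submonoid.mem_powers_iff _ _).mp (mem_powers_of_prime_card hcard hg1 (g' := g'))
    induction m with
    | zero => rw [pow_zero, AlgEquiv.one_apply]
    | succ m ih => rw [pow_succ, AlgEquiv.mul_apply, hz]; exact ih
  have hσK : ∀ z : K', σ z = z → z ∈ Kfix := fun z hz =>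
    (hKfix z).mpr fun h hh => by
      obtain ⟨g', rfl⟩ := hGfin h hh
      exact hfixall z hz g'
  -- the frame action on the r.s.p.: `σ xᵢ = xᵢ (1 + η)^{(A·N)ᵢ}`; NORM ONE from the moved coordinate
  have hU0 : (1 + η) ≠ 0 := ne_zero_of_valuation_eq_one (valuation_one_add_eq_one O' hηv)
  let N' : Fin d → ℤ := fun i => ∑ j, N j * (A i j : ℤ)
  have hσx : ∀ i, σ (x i) = x i * (1 + η) ^ N' i := by
    intro i
    rw [hmon i, map_prod, ← prod_zpow_eq_zpow_sum₀ hU0, ← Finset.prod_mul_distrib]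
    refine Finset.prod_congr rfl fun j _ => ?_
    rw [map_pow, show σ (x' j) = x' j * (1 + η) ^ N j from htw j, mul_pow, ← zpow_natCast ((1 + η) ^ N j),
      ← zpow_mul]
  have hx0 : ∀ i, x i ≠ 0 := fun i => by
    rw [hmon i]; exact Finset.prod_ne_zero_iff.mpr fun j _ => pow_ne_zero _ (hx' j).1
  have hnorm : ∏ i ∈ Finset.range p, (σ ^ i) (1 + η) = 1 :=
    norm_eq_one O' p hσO hσp hηv (hx' j₁).1 hN (htw j₁)
  -- the invariant model is Noetherian and universally catenary at the centre (Artin–Tate)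
  haveI : IsNoetherianRing (M ⊓ Kfix.toSubring : Subring K') :=
    isNoetherianRing_inf_fixed Gfin Kfix M h1G hmulG hKfix hMH S' hS'K t₀ hMgen
  obtain ⟨t, htsub, hteq⟩ := exists_finset_inf_fixed_eq_closure Gfin Kfix M h1G hmulG hKfix hMH S' hS'K t₀ hMgen
  have hTO : Subring.closure ((S' : Set K') ∪ (t : Set K')) ≤ O'.toSubring := by
    rw [← hteq]; exact inf_le_left.trans hMO
  have hAuc : IsUniversallyCatenaryRing (locAtCentre (M ⊓ Kfix.toSubring) O') := by
    rw [hteq]; exact isUniversallyCatenaryRing_locAtCentre_closure O' S' hSuc t hTO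
  -- THE ENGINE (landed, pivot-free)
  obtain ⟨y, hyK, hyO, hreg⟩ := exists_twisted_toric_chart O' p hpE h1G hmulG hKfix hHO hMO hMH hMreg hAuc
    S' hS'K hS'M t₀ hMgen hresO hσG hσp hσK hx hx0 hgen hdim ⟨hηB, hηv⟩ hη0 N' hσx hnorm
  -- transport `ι(R)[t ∪ y]` down to `K`
  have ht_sub : ((t ∪ y : Finset K') : Set K') ⊆ Set.range ι := by
    intro z hz
    rw [Finset.coe_union] at hz
    rcases hz with hz | hz
    · exact RingHom.mem_fieldRange.mp (Subring.mem_inf.mp (htsub hz)).2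
    · exact RingHom.mem_fieldRange.mp (hyK hz)
  have hcl : Subring.closure ((S' : Set K') ∪ ((t ∪ y : Finset K') : Set K')) =
      Subring.closure (((M ⊓ Kfix.toSubring : Subring K') : Set K') ∪ (y : Set K')) := by
    rw [hteq, WildTwistedToricLU.closure_closure_union, Finset.coe_union, Set.union_assoc]
  have hTO' : Subring.closure ((S' : Set K') ∪ ((t ∪ y : Finset K') : Set K')) ≤ O'.toSubring := by
    rw [hcl]
    refine Subring.closure_le.mpr (Set.union_subset (inf_le_left.trans hMO) fun z hz => hyO z hz)
  have hTreg : IsRegularLocalRing (locAtCentre (Subring.closure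
      ((S' : Set K') ∪ ((t ∪ y : Finset K') : Set K'))) O') := by
    rw [hcl]; exact hreg
  exact relLU_transport hO'O hRfg (t ∪ y) ht_sub hTO' hTreg

/-- Fully-qualified audit example: the law decides the kind `λ₁` verbatim. -/
example {O : ValuationSubring K}
    (h : Summit.ResolutionOfSingularities.ResolutionOfSingularities.Theorems.WildCocycleLU.WildLogCyclicAbove k O) :
    Literature.AlgebraicGeometry.Resolution.RelLocalUniformization k K O :=
  relLU_of_wildLogCyclicAbove h

/-- CONTROL: composed with `λ′ ⊆ λ₁`, the law RE-DERIVES the landed `λ′`-law `relLU_of_wildLogDiagonalUnluckyAbove`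
(hence also g32's lucky cell) — the pivot clause was never load-bearing. -/
example {O : ValuationSubring K} (h : WildLogDiagonalUnluckyAbove k O) : RelLocalUniformization k K O :=
  relLU_of_wildLogCyclicAbove (wildLogCyclicAbove_of_wildLogDiagonalUnluckyAbove h)

/-- CONTROL: … and g32's lucky binomial cell. -/
example {O : ValuationSubring K} (h : WildLogDiagonalLUAbove k O) : RelLocalUniformization k K O :=
  relLU_of_wildLogCyclicAbove (wildLogCyclicAbove_of_wildLogDiagonalUnluckyAbove
    (wildLogDiagonalUnluckyAbove_of_wildLogDiagonalLUAbove h))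

end Law

end Summit.ResolutionOfSingularities.ResolutionOfSingularities.Theorems.WildCocycleLU

end
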